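import Mathlib
import Summits.MatrixMultiplication.Statement
import Literature.Computability.AlgebraicComplexity.TensorRestrictionRank
import Summits.MatrixMultiplication.MatrixMultiplication.Theorems.GraphEquationsLadderDial
import Summits.MatrixMultiplication.MatrixMultiplication.Theorems.GraphEquationsCoeffIdentity

/-!
# Graph equations — THE ε-DIAL: every rung of the finite range made NECESSARY (M21b, decomp-mm-lens-5 g34)

(supports `MultiplicityReduction`, stmt-MatrixMultiplication-27806; companion of `GraphEquationsLadderDial`
(M20a) and `GraphEquationsNullExpLadder` (M19e).  No new definition.)

M20a measured the finite range of `MultiplicityReduction` by FIXED rung costs `Φ(e)`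
(`RUNG_Φ(e)`: `f_q^e ∈ J_E ⇒ R(⟨n,n,n⟩) ≤ Φ(e)·(cost E + n²)`).  A fixed constant is an `H`-type
statement: it could fail although `ω = 2`.  Loosening the constant to a SUBPOLYNOMIAL FACTOR makes every
rung a CONSEQUENCE of the summit, at no cost to the bridge:

  RUNG^ε(e) :  ∀ ε > 0 ∃ C ∀ n ≥ 1 ∀ E correct of format n with f_q^e ∈ J_E (∀ q):
               R(⟨n,n,n⟩) ≤ C · n^ε · (cost E + n²).

* `epsRung_of_matrixMultiplication` — **NEC**: `ω = 2 ⇒ RUNG^ε(e)` for every `e` (`R(n) ≤ C_ε n^{2+ε}`).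
* `epsRung_of_rankRung` — a fixed-constant rung is an ε-rung; hence `epsRung_one`, `epsRung_two`
  (M19i, M19m: rungs `e ≤ 2` hold with `ε = 0`).
* `multiplicityReduction_of_epsDial` — **THE ε-DIAL BRIDGE**: `(∀ e ≥ 1, RUNG^ε(e)) ∧ NER ⇒
  MultiplicityReduction` (NER names a uniform exponent `e` along a cost-`n^{β'}` family; the ε-rung at
  `ε < β* - β'` makes `β' + ε` admissible for `ω`);  `multiplicityReduction_of_epsDial_ge_three` — with
  rungs `e ≤ 2` plugged in.
* `matrixMultiplication_iff_epsDial` — **AN EXACT SPLIT OF THE SUMMIT INTO INDIVIDUALLY NECESSARY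
  PIECES**: `ω = 2 ⟺ V ∧ NER ∧ (∀ e ≥ 3, RUNG^ε(e))`, and given `V`,
  `MultiplicityReduction ⟺ NER ∧ (∀ e ≥ 3, RUNG^ε(e))` (`multiplicityReduction_iff_epsDial_of_quadratic`).
  Lens 5's question «how far must the finite range reach» thus has a sharp form: under NER with exponent
  `e⋆`, exactly to the ε-rung `e⋆`; every ε-rung is forced by the summit; the first open one is `e = 3`.
-/

set_option linter.dupNamespace false

noncomputable section

open scoped BigOperators

namespace Summit.MatrixMultiplication.MatrixMultiplication.Theorems.GraphEquations

open MvPolynomial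
open Literature.Computability.AlgebraicComplexity
open Literature.Computability.AlgebraicComplexity.ArithCircuit

variable {n : ℕ}

/-! ## ε-rungs are necessary -/

/-- **NEC**: `ω = 2 ⇒ RUNG^ε(e)` for every `e` — indeed `R(⟨n,n,n⟩) ≤ C_ε·n^{2+ε} ≤ C_ε·n^ε·(cost + n²)`
regardless of the system. -/
theorem epsRung_of_matrixMultiplication (hS : _root_.MatrixMultiplication) (e : ℕ) :
    ∀ ε : ℝ, 0 < ε → ∃ C : ℝ, ∀ n : ℕ, 1 ≤ n → ∀ E : EqSystem n, E.Correct →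
      (∀ q : Fin n × Fin n, generator n q ^ e ∈
        Ideal.span (Set.range fun o : Fin E.tests.length => E.testPoly (E.tests.get o))) →
      (tensorRank (matMulTensor ℂ n n n) : ℝ) ≤ C * (n : ℝ) ^ ε * ((E.cost : ℝ) + n * n) := by
  intro ε hε
  have h2 : omega ℂ = 2 := hS
  obtain ⟨C, hC, hb⟩ := exists_tensorRank_matMulTensor_le_rpow ℂ hε
  refine ⟨C, fun n hn E _ _ => ?_⟩
  have hn0 : (0 : ℝ) < n := by exact_mod_cast hn
  have h1 := hb n hn
  rw [h2, Real.rpow_add hn0, show ((2 : ℝ)) = ((2 : ℕ) : ℝ) by norm_num, Real.rpow_natCast, sq] at h1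
  have hε0 : (0 : ℝ) ≤ (n : ℝ) ^ ε := Real.rpow_nonneg hn0.le ε
  have hcost : (0 : ℝ) ≤ (E.cost : ℝ) := Nat.cast_nonneg _
  calc (tensorRank (matMulTensor ℂ n n n) : ℝ) ≤ C * ((n : ℝ) * n * (n : ℝ) ^ ε) := h1
    _ = C * (n : ℝ) ^ ε * ((n : ℝ) * n) := by ring
    _ ≤ C * (n : ℝ) ^ ε * ((E.cost : ℝ) + n * n) := by
        apply mul_le_mul_of_nonneg_left (by linarith) (mul_nonneg hC.le hε0)

/-- A FIXED-CONSTANT rung (M20a's `RUNG_Φ(e)`) is an ε-rung. -/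
theorem epsRung_of_rankRung {e : ℕ} (Φe : ℝ)
    (h : ∀ n : ℕ, 1 ≤ n → ∀ E : EqSystem n, E.Correct →
      (∀ q : Fin n × Fin n, generator n q ^ e ∈
        Ideal.span (Set.range fun o : Fin E.tests.length => E.testPoly (E.tests.get o))) →
      (tensorRank (matMulTensor ℂ n n n) : ℝ) ≤ Φe * ((E.cost : ℝ) + n * n)) :
    ∀ ε : ℝ, 0 < ε → ∃ C : ℝ, ∀ n : ℕ, 1 ≤ n → ∀ E : EqSystem n, E.Correct →
      (∀ q : Fin n × Fin n, generator n q ^ e ∈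
        Ideal.span (Set.range fun o : Fin E.tests.length => E.testPoly (E.tests.get o))) →
      (tensorRank (matMulTensor ℂ n n n) : ℝ) ≤ C * (n : ℝ) ^ ε * ((E.cost : ℝ) + n * n) := by
  intro ε hε
  refine ⟨max Φe 0, fun n hn E hE hmem => ?_⟩
  have hn1 : (1 : ℝ) ≤ n := by exact_mod_cast hn
  have hε1 : (1 : ℝ) ≤ (n : ℝ) ^ ε := Real.one_le_rpow hn1 hε.le
  have hX : (0 : ℝ) ≤ (E.cost : ℝ) + n * n := by positivity
  calc (tensorRank (matMulTensor ℂ n n n) : ℝ) ≤ Φe * ((E.cost : ℝ) + n * n) := h n hn E hE hmem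
    _ ≤ max Φe 0 * ((E.cost : ℝ) + n * n) := mul_le_mul_of_nonneg_right (le_max_left _ _) hX
    _ = max Φe 0 * 1 * ((E.cost : ℝ) + n * n) := by ring
    _ ≤ max Φe 0 * (n : ℝ) ^ ε * ((E.cost : ℝ) + n * n) := by
        apply mul_le_mul_of_nonneg_right _ hX
        exact mul_le_mul_of_nonneg_left hε1 (le_max_right _ _)

/-- **ε-rung `e = 1`** (from `Φ(1) = 2`, M19i). -/
theorem epsRung_one :
    ∀ ε : ℝ, 0 < ε → ∃ C : ℝ, ∀ n : ℕ, 1 ≤ n → ∀ E : EqSystem n, E.Correct →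
      (∀ q : Fin n × Fin n, generator n q ^ 1 ∈
        Ideal.span (Set.range fun o : Fin E.tests.length => E.testPoly (E.tests.get o))) →
      (tensorRank (matMulTensor ℂ n n n) : ℝ) ≤ C * (n : ℝ) ^ ε * ((E.cost : ℝ) + n * n) :=
  epsRung_of_rankRung 2 rankRung_one

/-- **ε-rung `e = 2`** (from `Φ(2) = 6`, M19m). -/
theorem epsRung_two :
    ∀ ε : ℝ, 0 < ε → ∃ C : ℝ, ∀ n : ℕ, 1 ≤ n → ∀ E : EqSystem n, E.Correct →
      (∀ q : Fin n × Fin n, generator n q ^ 2 ∈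
        Ideal.span (Set.range fun o : Fin E.tests.length => E.testPoly (E.tests.get o))) →
      (tensorRank (matMulTensor ℂ n n n) : ℝ) ≤ C * (n : ℝ) ^ ε * ((E.cost : ℝ) + n * n) :=
  epsRung_of_rankRung 6 rankRung_two

/-! ## The ε-dial bridge -/

/-- **THE ε-DIAL BRIDGE**: `(∀ e ≥ 1, RUNG^ε(e)) ∧ NER ⇒ MultiplicityReduction`.  NER at the exponent
`β' = (β + β⋆)/2` names `e` and a cost-`n^{β'}` family with `f_q^e ∈ J_E`; the ε-rung at `ε = (β⋆ - β')/2`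
gives `R(⟨n,n,n⟩) ≤ K·n^{β'+ε}`, so `ω ≤ β' + ε < β⋆` and `EqAdmissibleRed β⋆`. -/
theorem multiplicityReduction_of_epsDial
    (hRUNG : ∀ e : ℕ, 1 ≤ e → ∀ ε : ℝ, 0 < ε → ∃ C : ℝ, ∀ n : ℕ, 1 ≤ n → ∀ E : EqSystem n,
      E.Correct → (∀ q : Fin n × Fin n, generator n q ^ e ∈
        Ideal.span (Set.range fun o : Fin E.tests.length => E.testPoly (E.tests.get o))) →
      (tensorRank (matMulTensor ℂ n n n) : ℝ) ≤ C * (n : ℝ) ^ ε * ((E.cost : ℝ) + n * n))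
    (hNER : ∀ β : ℝ, 2 ≤ β → EqAdmissible β → ∀ β' : ℝ, β < β' →
      ∃ e : ℕ, 1 ≤ e ∧ ∃ c : ℝ, ∀ n : ℕ, 1 ≤ n → ∃ E : EqSystem n, E.Correct ∧
        (∀ q : Fin n × Fin n, generator n q ^ e ∈
          Ideal.span (Set.range fun o : Fin E.tests.length => E.testPoly (E.tests.get o))) ∧
        (E.cost : ℝ) ≤ c * (n : ℝ) ^ β') :
    MultiplicityReduction := by
  intro β hβ hA βs hβs
  obtain ⟨e, he, c, hc⟩ := hNER β hβ hA ((β + βs) / 2) (by linarith)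
  obtain ⟨C, hC⟩ := hRUNG e he ((βs - β) / 4) (by linarith)
  have hω : omega ℂ ≤ (β + βs) / 2 + (βs - β) / 4 := by
    refine omega_le_of_rank_family_le (K := max C 0 * (c + 1)) fun n hn => ?_
    obtain ⟨E, hE, hmem, hcost⟩ := hc n hn
    have hn0 : (0 : ℝ) < n := by exact_mod_cast hn
    have h1 := hC n hn E hE hmem
    have hX : (0 : ℝ) ≤ (E.cost : ℝ) + n * n := by positivity
    have hε0 : (0 : ℝ) ≤ (n : ℝ) ^ ((βs - β) / 4) := Real.rpow_nonneg hn0.le _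
    have h2 : C * (n : ℝ) ^ ((βs - β) / 4) * ((E.cost : ℝ) + n * n) ≤
        max C 0 * (n : ℝ) ^ ((βs - β) / 4) * ((E.cost : ℝ) + n * n) :=
      mul_le_mul_of_nonneg_right (mul_le_mul_of_nonneg_right (le_max_left _ _) hε0) hX
    have h3 : (1 : ℝ) * ((E.cost : ℝ) + n * n) ≤ max 1 0 * (c + 1) * (n : ℝ) ^ ((β + βs) / 2) :=
      dial_absorb hn (by linarith) 1 c hcost
    rw [max_eq_left (zero_le_one : (0 : ℝ) ≤ 1), one_mul, one_mul] at h3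
    have h4 : max C 0 * (n : ℝ) ^ ((βs - β) / 4) * ((E.cost : ℝ) + n * n) ≤
        max C 0 * (n : ℝ) ^ ((βs - β) / 4) * ((c + 1) * (n : ℝ) ^ ((β + βs) / 2)) :=
      mul_le_mul_of_nonneg_left h3 (mul_nonneg (le_max_right _ _) hε0)
    have h5 : max C 0 * (n : ℝ) ^ ((βs - β) / 4) * ((c + 1) * (n : ℝ) ^ ((β + βs) / 2)) =
        max C 0 * (c + 1) * (n : ℝ) ^ ((β + βs) / 2 + (βs - β) / 4) := by
      rw [Real.rpow_add hn0]; ring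
    linarith
  exact eqAdmissibleRed_of_omega_lt (hω.trans_lt (by linarith))

/-- **Where the crux stands on the ε-dial**: given NER, `MultiplicityReduction` follows from the ε-rungs
`e ≥ 3` ALONE (rungs `1, 2` being theorems, with `ε = 0`). -/
theorem multiplicityReduction_of_epsDial_ge_three
    (hRUNG : ∀ e : ℕ, 3 ≤ e → ∀ ε : ℝ, 0 < ε → ∃ C : ℝ, ∀ n : ℕ, 1 ≤ n → ∀ E : EqSystem n,
      E.Correct → (∀ q : Fin n × Fin n, generator n q ^ e ∈
        Ideal.span (Set.range fun o : Fin E.tests.length => E.testPoly (E.tests.get o))) →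
      (tensorRank (matMulTensor ℂ n n n) : ℝ) ≤ C * (n : ℝ) ^ ε * ((E.cost : ℝ) + n * n))
    (hNER : ∀ β : ℝ, 2 ≤ β → EqAdmissible β → ∀ β' : ℝ, β < β' →
      ∃ e : ℕ, 1 ≤ e ∧ ∃ c : ℝ, ∀ n : ℕ, 1 ≤ n → ∃ E : EqSystem n, E.Correct ∧
        (∀ q : Fin n × Fin n, generator n q ^ e ∈
          Ideal.span (Set.range fun o : Fin E.tests.length => E.testPoly (E.tests.get o))) ∧
        (E.cost : ℝ) ≤ c * (n : ℝ) ^ β') :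
    MultiplicityReduction := by
  refine multiplicityReduction_of_epsDial (fun e he => ?_) hNER
  rcases Nat.lt_or_ge e 3 with h3 | h3
  · interval_cases e
    · exact epsRung_one
    · exact epsRung_two
  · exact hRUNG e h3

/-! ## The exact split -/

/-- **AN EXACT SPLIT OF THE SUMMIT INTO INDIVIDUALLY NECESSARY PIECES**:
`ω = 2 ⟺ V ∧ NER ∧ (∀ e ≥ 3, RUNG^ε(e))` — the residual `V`, the asymptotic hand NER, and the finite
range as a sequence of ε-rungs, each of which is itself forced by `ω = 2`. -/
theorem matrixMultiplication_iff_epsDial :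
    _root_.MatrixMultiplication ↔
      GraphEquationsQuadratic ∧
      (∀ β : ℝ, 2 ≤ β → EqAdmissible β → ∀ β' : ℝ, β < β' →
        ∃ e : ℕ, 1 ≤ e ∧ ∃ c : ℝ, ∀ n : ℕ, 1 ≤ n → ∃ E : EqSystem n, E.Correct ∧
          (∀ q : Fin n × Fin n, generator n q ^ e ∈
            Ideal.span (Set.range fun o : Fin E.tests.length => E.testPoly (E.tests.get o))) ∧
          (E.cost : ℝ) ≤ c * (n : ℝ) ^ β') ∧
      (∀ e : ℕ, 3 ≤ e → ∀ ε : ℝ, 0 < ε → ∃ C : ℝ, ∀ n : ℕ, 1 ≤ n → ∀ E : EqSystem n,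
        E.Correct → (∀ q : Fin n × Fin n, generator n q ^ e ∈
          Ideal.span (Set.range fun o : Fin E.tests.length => E.testPoly (E.tests.get o))) →
        (tensorRank (matMulTensor ℂ n n n) : ℝ) ≤ C * (n : ℝ) ^ ε * ((E.cost : ℝ) + n * n)) := by
  constructor
  · intro hS
    exact ⟨nec_quadratic hS, nullExpReduction_of_matrixMultiplication hS,
      fun e _ => epsRung_of_matrixMultiplication hS e⟩
  · rintro ⟨hV, hNER, hRUNG⟩
    exact matrixMultiplication_of_quadratic_of_multiplicityReduction hV
      (multiplicityReduction_of_epsDial_ge_three hRUNG hNER)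

/-- **The crux itself, given the residual**: under `V`, `MultiplicityReduction ⟺ NER ∧ (∀ e ≥ 3, RUNG^ε(e))`. -/
theorem multiplicityReduction_iff_epsDial_of_quadratic (hV : GraphEquationsQuadratic) :
    MultiplicityReduction ↔
      (∀ β : ℝ, 2 ≤ β → EqAdmissible β → ∀ β' : ℝ, β < β' →
        ∃ e : ℕ, 1 ≤ e ∧ ∃ c : ℝ, ∀ n : ℕ, 1 ≤ n → ∃ E : EqSystem n, E.Correct ∧
          (∀ q : Fin n × Fin n, generator n q ^ e ∈
            Ideal.span (Set.range fun o : Fin E.tests.length => E.testPoly (E.tests.get o))) ∧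
          (E.cost : ℝ) ≤ c * (n : ℝ) ^ β') ∧
      (∀ e : ℕ, 3 ≤ e → ∀ ε : ℝ, 0 < ε → ∃ C : ℝ, ∀ n : ℕ, 1 ≤ n → ∀ E : EqSystem n,
        E.Correct → (∀ q : Fin n × Fin n, generator n q ^ e ∈
          Ideal.span (Set.range fun o : Fin E.tests.length => E.testPoly (E.tests.get o))) →
        (tensorRank (matMulTensor ℂ n n n) : ℝ) ≤ C * (n : ℝ) ^ ε * ((E.cost : ℝ) + n * n)) := by
  constructor
  · intro hM
    have hS := matrixMultiplication_of_quadratic_of_multiplicityReduction hV hM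
    exact ⟨nullExpReduction_of_matrixMultiplication hS, fun e _ => epsRung_of_matrixMultiplication hS e⟩
  · rintro ⟨hNER, hRUNG⟩
    exact multiplicityReduction_of_epsDial_ge_three hRUNG hNER

end Summit.MatrixMultiplication.MatrixMultiplication.Theorems.GraphEquations

end
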